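import Summits.AnomalousDissipation.AnomalousDissipation.Theorems.SawtoothPulseCascadeK1LocalisedCascadeBlockJunkCTE

/-!
# K1loc — helper: THE SCALAR BOUNDS OF A GEOMETRIC BLOCK FAMILY OF ARBITRARY RATIO, CORNER-TRACE GRADE, AGGREGATE TRACKED
ENERGY (closed forms; companion of `…BlockJunkCTE`, finding F-p1g8-1 §2)

`…BlockJunkCTE` gives the four scalar bounds (trace sum `A`, residue coefficient `β*`, rounding coefficient `ρ*`, zone sum `Z`)
of the aggregate-energy class steps `…ClassBlocksCTE` on DYADIC blocks.  Here the same on a block family of arbitrary real ratio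
`ρ > 1` — envelopes `D_m ≥ D₀ρ^m`, `D_m + Q_m ≥ S₀ρ^m`, `0 ≤ Q_m ≤ q₀ρ^m`, `0 ≤ Λ'_m ≤ ℓ₀ρ^{m+1}`, `0 ≤ T_m ≤ r*`
(`…GeomBlocks` supplies them for `Λ_m = ⌊Λ₀aᵐ/bᵐ⌋`, `ρ = a/b`):
  `A = 6N²r*(ρ²/((ρ²−1)S₀²) + ρ/((ρ−1)NS₀))/π²` (`ctTraceGeom_sum_le`),
  `β* = 12N²(q₀/D₀)²(2q₀/(NS₀²) + 2q₀/(N²S₀) + 1/S₀² + 1/(NS₀))/π²` (`ctResidueGeom_le`, ratio-free: the lowest block is the worst),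
  `ρ* = (πℓ₀ρ^{M_b}ε/N)²` (`ctRoundGeom_le`); the zone sum is `…BlockJunkCTE.ctZone_sum_le` unchanged.
The point (sizing of record, ad-k1loc-p3 CT-PHASE23): `β* ∝ (q₀/D₀)²·q₀/S₀` is cubic in the lobe fraction, which the feed
inclusion forces to be proportional to `ρ`; at phase 3 the windows' junk drops from `0.015–0.034` (ρ = 2) to `0.004–0.008` (ρ = 9/8).
Pure real arithmetic; no definitions; no statement about the crux. [cite: Grafakos2014, Prop. 3.2.7 (3)] [problem: turb]
-/

-- `Summit.<Summit>.<Problem>`: single-conjunct summit, the duplicate namespace segment is deliberate.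
set_option linter.dupNamespace false

noncomputable section

namespace Summit.AnomalousDissipation.AnomalousDissipation.Theorems.SawtoothPulseCascade.K1Window

open Finset Real
open Summit.AnomalousDissipation.AnomalousDissipation.Theorems.SawtoothPulseCascade.K1Ledger.From

/-- **The CT kernel weight on a block of a ratio-`ρ` family**: `0 < S₀ρ^m ≤ D + Q`, `N > 0`, `ρ > 0` give
`1/(D+Q)² + 1/(N(D+Q)) ≤ (1/S₀²)((1/ρ)^m)² + (1/(NS₀))(1/ρ)^m`. [folklore] -/
theorem ctSigmaGeom_le {D Q N S₀ ρ : ℝ} {m : ℕ} (hN : 0 < N) (hS₀ : 0 < S₀) (hρ : 0 < ρ) (hS : S₀ * ρ ^ m ≤ D + Q) :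
    1 / (D + Q) ^ 2 + 1 / (N * (D + Q)) ≤ 1 / S₀ ^ 2 * ((1 / ρ) ^ m) ^ 2 + 1 / (N * S₀) * (1 / ρ) ^ m := by
  have hS2 : 0 < S₀ * ρ ^ m := by positivity
  have hN0 : N ≠ 0 := hN.ne'
  have hS0 : S₀ ≠ 0 := hS₀.ne'
  have hρ0 : ρ ≠ 0 := hρ.ne'
  have h2 : ρ ^ m ≠ 0 := pow_ne_zero _ hρ0
  have e1 : 1 / (S₀ * ρ ^ m) ^ 2 = 1 / S₀ ^ 2 * ((1 / ρ) ^ m) ^ 2 := by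
    field_simp
    rw [← mul_pow, ← mul_pow, mul_one_div_cancel hρ0, one_pow, one_pow]
  have e2 : 1 / (N * (S₀ * ρ ^ m)) = 1 / (N * S₀) * (1 / ρ) ^ m := by
    field_simp
    rw [← mul_pow, mul_one_div_cancel hρ0, one_pow]
  rw [← e1, ← e2]
  exact add_le_add (one_div_le_one_div_of_le (pow_pos hS2 2) (pow_le_pow_left₀ hS2.le hS 2))
    (one_div_le_one_div_of_le (by positivity) (mul_le_mul_of_nonneg_left hS hN.le))

/-- **The trace junk of a ratio-`ρ` block family** (`ρ > 1`):
`Σ_{m<M_b} 3Nσ_m/π²·(2N·T_m) ≤ 6N²r*(ρ²/((ρ²−1)S₀²) + ρ/((ρ−1)NS₀))/π²`. [folklore] -/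
theorem ctTraceGeom_sum_le {D Q T : ℕ → ℝ} {N S₀ rs ρ : ℝ} (hN : 0 < N) (hS₀ : 0 < S₀) (hρ : 1 < ρ)
    (hS : ∀ m, S₀ * ρ ^ m ≤ D m + Q m) (hT0 : ∀ m, 0 ≤ T m) (hT : ∀ m, T m ≤ rs) (Mb : ℕ) :
    ∑ m ∈ range Mb, 3 * N * (1 / (D m + Q m) ^ 2 + 1 / (N * (D m + Q m))) / π ^ 2 * (2 * N * T m) ≤
      6 * N ^ 2 * rs * (ρ ^ 2 / ((ρ ^ 2 - 1) * S₀ ^ 2) + ρ / ((ρ - 1) * (N * S₀))) / π ^ 2 := by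
  have hπ := Real.pi_pos
  have hρ0 : 0 < ρ := by linarith
  have hrs : 0 ≤ rs := (hT0 0).trans (hT 0)
  -- per block
  have hblk : ∀ m, 3 * N * (1 / (D m + Q m) ^ 2 + 1 / (N * (D m + Q m))) / π ^ 2 * (2 * N * T m) ≤
      6 * N ^ 2 * rs / π ^ 2 * (1 / S₀ ^ 2 * ((1 / ρ) ^ m) ^ 2 + 1 / (N * S₀) * (1 / ρ) ^ m) := fun m => by
    have hσs := ctSigmaGeom_le hN hS₀ hρ0 (hS m)
    have hDQ : 0 < D m + Q m := lt_of_lt_of_le (by positivity) (hS m)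
    have hσ0 : 0 ≤ 1 / (D m + Q m) ^ 2 + 1 / (N * (D m + Q m)) := by positivity
    have hs0 : 0 ≤ 1 / S₀ ^ 2 * ((1 / ρ) ^ m) ^ 2 + 1 / (N * S₀) * (1 / ρ) ^ m := hσ0.trans hσs
    have h := mul_le_mul hσs (hT m) (hT0 m) hs0
    have e1 : 3 * N * (1 / (D m + Q m) ^ 2 + 1 / (N * (D m + Q m))) / π ^ 2 * (2 * N * T m) =
        6 * N ^ 2 / π ^ 2 * ((1 / (D m + Q m) ^ 2 + 1 / (N * (D m + Q m))) * T m) := by ring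
    have e2 : 6 * N ^ 2 * rs / π ^ 2 * (1 / S₀ ^ 2 * ((1 / ρ) ^ m) ^ 2 + 1 / (N * S₀) * (1 / ρ) ^ m) =
        6 * N ^ 2 / π ^ 2 * ((1 / S₀ ^ 2 * ((1 / ρ) ^ m) ^ 2 + 1 / (N * S₀) * (1 / ρ) ^ m) * rs) := by ring
    rw [e1, e2]
    exact mul_le_mul_of_nonneg_left h (by positivity)
  -- the two geometric sums
  have hX : ∑ m ∈ range Mb, ((1 / ρ) ^ m) ^ 2 ≤ ρ ^ 2 / (ρ ^ 2 - 1) := by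
    have e : ∀ m : ℕ, ((1 / ρ) ^ m) ^ 2 = (1 / ρ ^ 2) ^ m := fun m => by
      rw [← pow_mul, mul_comm, pow_mul, one_div_pow]
    simp_rw [e]
    exact sum_range_inv_pow_le_of_lt (ρ := ρ ^ 2) (by nlinarith) Mb
  have hY : ∑ m ∈ range Mb, (1 / ρ) ^ m ≤ ρ / (ρ - 1) := sum_range_inv_pow_le_of_lt hρ Mb
  calc ∑ m ∈ range Mb, 3 * N * (1 / (D m + Q m) ^ 2 + 1 / (N * (D m + Q m))) / π ^ 2 * (2 * N * T m)
      ≤ ∑ m ∈ range Mb, 6 * N ^ 2 * rs / π ^ 2 * (1 / S₀ ^ 2 * ((1 / ρ) ^ m) ^ 2 + 1 / (N * S₀) * (1 / ρ) ^ m) :=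
        sum_le_sum fun m _ => hblk m
    _ = 6 * N ^ 2 * rs / π ^ 2 * (1 / S₀ ^ 2 * ∑ m ∈ range Mb, ((1 / ρ) ^ m) ^ 2 +
          1 / (N * S₀) * ∑ m ∈ range Mb, (1 / ρ) ^ m) := by
        rw [← mul_sum, sum_add_distrib, mul_sum, mul_sum]
    _ ≤ 6 * N ^ 2 * rs / π ^ 2 * (1 / S₀ ^ 2 * (ρ ^ 2 / (ρ ^ 2 - 1)) + 1 / (N * S₀) * (ρ / (ρ - 1))) := by
        refine mul_le_mul_of_nonneg_left (add_le_add (mul_le_mul_of_nonneg_left hX (by positivity))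
          (mul_le_mul_of_nonneg_left hY (by positivity))) (by positivity)
    _ = 6 * N ^ 2 * rs * (ρ ^ 2 / ((ρ ^ 2 - 1) * S₀ ^ 2) + ρ / ((ρ - 1) * (N * S₀))) / π ^ 2 := by
        have h1 : ρ ^ 2 - 1 ≠ 0 := by nlinarith
        have h2 : ρ - 1 ≠ 0 := by linarith
        field_simp

/-- **The residue coefficient of a block of a ratio-`ρ` family** (`ρ ≥ 1`): gap `D ≥ D₀ρ^m`, span `D + Q ≥ S₀ρ^m`, lobe
`0 ≤ Q ≤ q₀ρ^m` give `12N²Q²(2Q/N+1)σ/(π²D²) ≤ 12N²(q₀/D₀)²(2q₀/(NS₀²) + 2q₀/(N²S₀) + 1/S₀² + 1/(NS₀))/π²`. [folklore] -/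
theorem ctResidueGeom_le {D Q N D₀ S₀ q₀ ρ : ℝ} {m : ℕ} (hN : 0 < N) (hD₀ : 0 < D₀) (hS₀ : 0 < S₀) (hq₀ : 0 ≤ q₀)
    (hρ : 1 ≤ ρ) (hD : D₀ * ρ ^ m ≤ D) (hS : S₀ * ρ ^ m ≤ D + Q) (hQ0 : 0 ≤ Q) (hQ : Q ≤ q₀ * ρ ^ m) :
    12 * N ^ 2 * Q ^ 2 * (2 * Q / N + 1) * (1 / (D + Q) ^ 2 + 1 / (N * (D + Q))) / (π ^ 2 * D ^ 2) ≤
      12 * N ^ 2 * (q₀ / D₀) ^ 2 * (2 * q₀ / (N * S₀ ^ 2) + 2 * q₀ / (N ^ 2 * S₀) + 1 / S₀ ^ 2 + 1 / (N * S₀)) / π ^ 2 := by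
  have hπ := Real.pi_pos
  have hρ0 : 0 < ρ := by linarith
  have hN0 : N ≠ 0 := hN.ne'
  have hS0 : S₀ ≠ 0 := hS₀.ne'
  have hD00 : D₀ ≠ 0 := hD₀.ne'
  have hπ0 : (π : ℝ) ≠ 0 := hπ.ne'
  have hρ0' : ρ ≠ 0 := hρ0.ne'
  set σ : ℝ := 1 / (D + Q) ^ 2 + 1 / (N * (D + Q)) with hσ
  set s : ℝ := 1 / S₀ ^ 2 * ((1 / ρ) ^ m) ^ 2 + 1 / (N * S₀) * (1 / ρ) ^ m with hs
  have hσs : σ ≤ s := ctSigmaGeom_le hN hS₀ hρ0 hS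
  have hDQ : 0 < D + Q := lt_of_lt_of_le (by positivity) hS
  have hσ0 : 0 ≤ σ := by positivity
  have hDpos : 0 < D := lt_of_lt_of_le (by positivity) hD
  have hD0' : D ≠ 0 := hDpos.ne'
  -- the lobe/gap ratio
  have hQD : Q ≤ q₀ / D₀ * D := by
    calc Q ≤ q₀ * ρ ^ m := hQ
      _ = q₀ / D₀ * (D₀ * ρ ^ m) := by field_simp
      _ ≤ q₀ / D₀ * D := mul_le_mul_of_nonneg_left hD (by positivity)
  have hQ2 : Q ^ 2 ≤ (q₀ / D₀) ^ 2 * D ^ 2 := by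
    rw [← mul_pow]; exact pow_le_pow_left₀ hQ0 hQD 2
  have hQD2 : Q ^ 2 / D ^ 2 ≤ (q₀ / D₀) ^ 2 := by
    rw [div_le_iff₀ (by positivity)]; exact hQ2
  -- the geometric factors are at most one
  have hh : (1 / ρ) ^ m ≤ 1 := pow_le_one₀ (by positivity) (by rw [div_le_one hρ0]; exact hρ)
  have hh2 : ((1 / ρ) ^ m) ^ 2 ≤ 1 := pow_le_one₀ (by positivity) hh
  have h2m : ρ ^ m * ((1 / ρ) ^ m) ^ 2 = (1 / ρ) ^ m := by
    rw [sq, ← mul_assoc, ← mul_pow, mul_one_div_cancel hρ0', one_pow, one_mul]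
  have h2m' : ρ ^ m * (1 / ρ) ^ m = 1 := by rw [← mul_pow, mul_one_div_cancel hρ0', one_pow]
  have hfac : (2 * Q / N + 1) * σ ≤ 2 * q₀ / (N * S₀ ^ 2) + 2 * q₀ / (N ^ 2 * S₀) + 1 / S₀ ^ 2 + 1 / (N * S₀) := by
    have hα : 2 * Q / N + 1 ≤ 2 * (q₀ * ρ ^ m) / N + 1 := by
      have := div_le_div_of_nonneg_right (mul_le_mul_of_nonneg_left hQ zero_le_two) hN.le
      linarith
    calc (2 * Q / N + 1) * σ ≤ (2 * (q₀ * ρ ^ m) / N + 1) * s := mul_le_mul hα hσs hσ0 (by positivity)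
      _ = 2 * q₀ / (N * S₀ ^ 2) * (ρ ^ m * ((1 / ρ) ^ m) ^ 2) +
            2 * q₀ / (N ^ 2 * S₀) * (ρ ^ m * (1 / ρ) ^ m) + s := by
          rw [hs]; ring
      _ = 2 * q₀ / (N * S₀ ^ 2) * (1 / ρ) ^ m + 2 * q₀ / (N ^ 2 * S₀) +
            (1 / S₀ ^ 2 * ((1 / ρ) ^ m) ^ 2 + 1 / (N * S₀) * (1 / ρ) ^ m) := by rw [h2m, h2m', mul_one]
      _ ≤ 2 * q₀ / (N * S₀ ^ 2) * 1 + 2 * q₀ / (N ^ 2 * S₀) + (1 / S₀ ^ 2 * 1 + 1 / (N * S₀) * 1) := by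
          have h1 := mul_le_mul_of_nonneg_left hh (by positivity : (0 : ℝ) ≤ 2 * q₀ / (N * S₀ ^ 2))
          have h2 := mul_le_mul_of_nonneg_left hh2 (by positivity : (0 : ℝ) ≤ 1 / S₀ ^ 2)
          have h3 := mul_le_mul_of_nonneg_left hh (by positivity : (0 : ℝ) ≤ 1 / (N * S₀))
          linarith
      _ = _ := by ring
  have hβ0 : 0 ≤ (2 * Q / N + 1) * σ := mul_nonneg (by positivity) hσ0
  calc 12 * N ^ 2 * Q ^ 2 * (2 * Q / N + 1) * σ / (π ^ 2 * D ^ 2)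
      = 12 * N ^ 2 / π ^ 2 * (Q ^ 2 / D ^ 2) * ((2 * Q / N + 1) * σ) := by
        field_simp
    _ ≤ 12 * N ^ 2 / π ^ 2 * (q₀ / D₀) ^ 2 * (2 * q₀ / (N * S₀ ^ 2) + 2 * q₀ / (N ^ 2 * S₀) + 1 / S₀ ^ 2 + 1 / (N * S₀)) :=
        mul_le_mul (mul_le_mul_of_nonneg_left hQD2 (by positivity)) hfac hβ0 (by positivity)
    _ = _ := by ring

/-- **The rounding coefficient below the top of a ratio-`ρ` family** (`ρ ≥ 1`): `0 ≤ Λ' ≤ ℓ₀ρ^{m+1}`, `m < M_b`, `ε ≥ 0`, `N > 0` give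
`(πΛ'ε/N)² ≤ (πℓ₀ρ^{M_b}ε/N)²`. [folklore] -/
theorem ctRoundGeom_le {Λ' N ℓ₀ ε ρ : ℝ} {m Mb : ℕ} (hN : 0 < N) (hε : 0 ≤ ε) (hℓ₀ : 0 ≤ ℓ₀) (hρ : 1 ≤ ρ) (hΛ0 : 0 ≤ Λ')
    (hΛ : Λ' ≤ ℓ₀ * ρ ^ (m + 1)) (hm : m < Mb) :
    (π * Λ' * ε / N) ^ 2 ≤ (π * ℓ₀ * ρ ^ Mb * ε / N) ^ 2 := by
  have hπ := Real.pi_pos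
  have h2 : ρ ^ (m + 1) ≤ ρ ^ Mb := pow_le_pow_right₀ hρ (Nat.succ_le_of_lt hm)
  have hΛ' : Λ' ≤ ℓ₀ * ρ ^ Mb := hΛ.trans (mul_le_mul_of_nonneg_left h2 hℓ₀)
  have h0 : 0 ≤ π * Λ' * ε / N := by positivity
  exact pow_le_pow_left₀ h0 (div_le_div_of_nonneg_right (mul_le_mul_of_nonneg_right
    (by nlinarith [mul_le_mul_of_nonneg_left hΛ' hπ.le]) hε) hN.le) 2

end Summit.AnomalousDissipation.AnomalousDissipation.Theorems.SawtoothPulseCascade.K1Window
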